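import Mathlib
import Summits.KontsevichZagierPeriods.KontsevichZagierPeriods.Theorems.SoloInformedScaleStep
import Summits.KontsevichZagierPeriods.KontsevichZagierPeriods.Theorems.SoloInformedHookStage
import Summits.KontsevichZagierPeriods.KontsevichZagierPeriods.Theorems.SoloInformedZetaFourStep
import HarnessLib
import HarnessLib.Audit

/-!
# SoloInformed — the hook identities: the chain of scale band steps (F3c)

Solo programme `solo-KontsevichZagierPeriods-informed`, session s54 (PROGRAMME LIII).

THEOREM (`SoloInformedHookStage.chain`).  For a hook stage (file F3b: labelling `β`, blocks
`0,…,K`, position `pos` of `a`, placed coordinates `bs`, hanging decreasing chain `c, cs`) whose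
first `A`-side

  `[(0,1)^N ∩ {chain} ∩ {x_c < x_A},  HookSum(bs)/(∏_{t ∈ cs}(1 − x_t)·(1 − x_c))]`

is integrable, the scale band steps (THEOREM XLIX, one per hanging coordinate, each `B`-side being
the next `A`-side) give

  `[A] − [(0,1)^N, HookSum(bs ++ c :: cs)] ∈ KZ.relations`,

the placement sum of ALL hanging coordinates on the full cube (`hookRep`).  Its final states are
cube words (file F1d), so its class is a sum of `mzvClass`es (next file); with `bs = []`
(`repA_domain_of_nil`, `repA_integrand_of_nil`), `β` the labelling of an admissible index `u` and
`i` hanging coordinates this is the series side of Kaneko–Yamamoto's integral–series identity for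
the hook index `μ(u, (1^i))`.

References: M. Kaneko, S. Yamamoto, arXiv:1605.03117, Thm 4.1, Prop. 5.4; M. Hoffman, Pacific J.
Math. 152 (1992) Thm 5.1; Kontsevich–Zagier 2001 §1.2 [KontsevichZagier2001].
-/

noncomputable section

open MeasureTheory Set MvPolynomial
open Literature.ModelTheory.ExponentialFields Literature.NumberTheory.Transcendental
open Literature.NumberTheory.Transcendental.KZ

namespace Summit.KontsevichZagierPeriods.KontsevichZagierPeriods.Theorems

namespace SoloInformedHookStage

variable {N : ℕ} (S : SoloInformedHookStage N)

/-! ## 5. The cube representation of a placement sum -/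

/-- `[(0,1)^N, HookSum(ℓ)]` for a placement sum known to be integrable on the cube. -/
def hookRep {β : Fin N → ℕ} {K pos : ℕ} {ℓ : List (Fin N)} (hL : soloInformedIsLabK β K)
    (hpos : pos ≤ K) (hub : ∀ x ∈ ℓ, K < β x) (hnd : ℓ.Nodup)
    (hI : IntegrableOn (fun x => soloInformedHookSum x β K pos ℓ) (soloInformedOpenCube N)) :
    IntegralRep N where
  domain := soloInformedOpenCube N
  integrand x := soloInformedHookSum x β K pos ℓ
  isSemialgebraic_domain := isSemialgebraic_soloInformedOpenCube N
  isSemialgebraicFunOn_integrand :=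
    soloInformed_isSemialgebraicFunOn_quot (isSemialgebraic_soloInformedOpenCube N) _ _ _
      (fun _ hx => (soloInformed_hookPQ_snd_pos_open hL hpos hub hnd hx).ne')
      fun _ hx => soloInformed_hookPQ_div_open hL hpos hub hnd hx
  integrableOn := hI

/-! ## 6. The chain theorem -/

/-- The chain, by induction on the number of hanging coordinates below `c`. -/
theorem chain_aux : ∀ (n : ℕ) (S : SoloInformedHookStage N), S.cs.length = n →
    ∀ hA : IntegrableOn S.pre.fA S.pre.T₀.DA,
    ∃ r : IntegralRep N, r.domain = soloInformedOpenCube N ∧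
      EqOn r.integrand (fun x => soloInformedHookSum x S.β S.K S.pos (S.bs ++ S.c :: S.cs))
        (soloInformedOpenCube N) ∧
      of (S.pre.toDatum hA).repA - of r ∈ relations
  | 0, S, hn, hA => by
    have hS : S.cs = [] := List.length_eq_zero_iff.1 hn
    have hD : S.pre.T₀.D = soloInformedOpenCube N := by
      rw [SoloInformedScalePre.T₀_D, pre_D, hS, soloInformedChainSet_nil, inter_univ]
    have hfB : ∀ x ∈ soloInformedOpenCube N,
        S.pre.fB x = soloInformedHookSum x S.β S.K S.pos (S.bs ++ S.c :: S.cs) := by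
      intro x hx
      rw [S.pre_fB hx, hS]
      simp
    have hI : IntegrableOn (fun x => soloInformedHookSum x S.β S.K S.pos (S.bs ++ S.c :: S.cs))
        (soloInformedOpenCube N) := by
      have h := S.pre.integrableOn_fB hA
      rw [hD] at h
      exact h.congr_fun hfB (soloInformed_measurableSet_openCube N)
    refine ⟨hookRep S.isLabK S.pos_le S.lt_β S.nodup hI, rfl, fun x _ => rfl, ?_⟩
    have h2 : of (S.pre.toDatum hA).repB - of (hookRep S.isLabK S.pos_le S.lt_β S.nodup hI) ∈
        relations :=
      of_sub_of_mem_relations_of_eqOn (by rw [SoloInformedScaleDatum.repB_domain]; exact hD.symm)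
        fun x hx => by
          rw [SoloInformedScaleDatum.repB_integrand, SoloInformedScalePre.toDatum_fB]
          exact hfB x (hD ▸ hx)
    have e : of (S.pre.toDatum hA).repA - of (hookRep S.isLabK S.pos_le S.lt_β S.nodup hI) =
        (of (S.pre.toDatum hA).repA - of (S.pre.toDatum hA).repB) +
          (of (S.pre.toDatum hA).repB - of (hookRep S.isLabK S.pos_le S.lt_β S.nodup hI)) := by
      abel
    rw [e]
    exact relations.add_mem (S.pre.toDatum hA).scale h2
  | n + 1, S, hn, hA => by
    obtain ⟨c', cs', hS⟩ : ∃ c' cs', S.cs = c' :: cs' := by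
      cases hS : S.cs with
      | nil => rw [hS] at hn; simp at hn
      | cons c' cs' => exact ⟨c', cs', rfl⟩
    have hn' : (S.next c' cs' hS).cs.length = n := by
      rw [hS] at hn
      simpa [next] using hn
    have hA' := S.next_integrableOn c' cs' hS hA
    obtain ⟨r, hrd, hri, hrel⟩ := chain_aux n (S.next c' cs' hS) hn' hA'
    have hl : (S.next c' cs' hS).bs ++ (S.next c' cs' hS).c :: (S.next c' cs' hS).cs =
        S.bs ++ S.c :: S.cs := by
      simp [next, hS]
    refine ⟨r, hrd, fun x hx => by rw [hri hx, hl]; rfl, ?_⟩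
    have h2 : of (S.pre.toDatum hA).repB - of ((S.next c' cs' hS).pre.toDatum hA').repA ∈
        relations :=
      of_sub_of_mem_relations_of_eqOn
        (by
          rw [SoloInformedScaleDatum.repB_domain, SoloInformedScaleDatum.repA_domain]
          exact S.next_DA c' cs' hS)
        fun x hx => by
          rw [SoloInformedScaleDatum.repB_integrand, SoloInformedScalePre.toDatum_fB,
            SoloInformedScaleDatum.repA_integrand, SoloInformedScalePre.toDatum_fA]
          exact S.next_fA c' cs' hS hx
    have e : of (S.pre.toDatum hA).repA - of r =
        (of (S.pre.toDatum hA).repA - of (S.pre.toDatum hA).repB) +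
          (of (S.pre.toDatum hA).repB - of ((S.next c' cs' hS).pre.toDatum hA').repA) +
          (of ((S.next c' cs' hS).pre.toDatum hA').repA - of r) := by
      abel
    rw [e]
    exact relations.add_mem (relations.add_mem (S.pre.toDatum hA).scale h2) hrel

/-- **THE CHAIN OF SCALE BAND STEPS.** For a hook stage whose `A`-side
`[(0,1)^N ∩ {chain} ∩ {x_c < x_A}, HookSum(bs)/(∏_{t ∈ cs}(1 − x_t)(1 − x_c))]` is integrable,
`[A] − [(0,1)^N, HookSum(bs ++ c :: cs)] ∈ KZ.relations`: the placement sum of all hanging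
coordinates, on the full cube. [KZ 2001 §1.2 rules (1)–(3), via THEOREM XLIX per coordinate] -/
theorem chain (hA : IntegrableOn S.pre.fA S.pre.T₀.DA) :
    ∃ r : IntegralRep N, r.domain = soloInformedOpenCube N ∧
      EqOn r.integrand (fun x => soloInformedHookSum x S.β S.K S.pos (S.bs ++ S.c :: S.cs))
        (soloInformedOpenCube N) ∧
      of (S.pre.toDatum hA).repA - of r ∈ relations :=
  chain_aux S.cs.length S rfl hA

/-! ## 7. The first `A`-side -/

/-- **The first `A`-side** (`bs = []`): domain `(0,1)^N ∩ {chain below c} ∩ {x_c < x_a}`. -/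
theorem repA_domain_of_nil (hA : IntegrableOn S.pre.fA S.pre.T₀.DA) (h0 : S.bs = []) :
    (S.pre.toDatum hA).repA.domain =
      soloInformedOpenCube N ∩ soloInformedChainSet S.c S.cs ∩ {x | x S.c < x S.a} := by
  rw [SoloInformedScaleDatum.repA_domain]
  have h := S.pre_DA
  rw [SoloInformedScaleDatum.DA] at h
  rw [show S.A = S.a by rw [A, h0, soloInformedLastD_nil]] at h
  exact h

/-- **The first `A`-side** (`bs = []`): integrand `G(Q_0(x),…,Q_K(x))/(∏_{t∈cs}(1 − x_t)(1 − x_c))`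
on the cube, `Q_t` the chain products of `β`. -/
theorem repA_integrand_of_nil (hA : IntegrableOn S.pre.fA S.pre.T₀.DA) (h0 : S.bs = [])
    {x : Fin N → ℝ} (hx : x ∈ soloInformedOpenCube N) :
    (S.pre.toDatum hA).repA.integrand x =
      soloInformedGQ (List.ofFn fun t : Fin (S.K + 1) => soloInformedBP S.β x t) /
        ((∏ t ∈ S.cs.toFinset, (1 - x t)) * (1 - x S.c)) := by
  rw [SoloInformedScaleDatum.repA_integrand, SoloInformedScalePre.toDatum_fA, S.pre_fA hx, h0,
    soloInformedHookSum_nil]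

end SoloInformedHookStage

end Summit.KontsevichZagierPeriods.KontsevichZagierPeriods.Theorems
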